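import Literature.AlgebraicGeometry.Deformation.FlatDeformationTransitionData
import Literature.AlgebraicGeometry.Deformation.SmoothSchemeLiftTransitionDataLift
import HarnessLib

/-!
# Two trivialisation systems of one flat deformation on one cover have intertwined transition lifts
# (Hartshorne, *Deformation Theory*, proof of Thm. 10.2 (a): independence of the trivialisations)

Layer `Literature/AlgebraicGeometry/Deformation`, namespace `Literature.AlgebraicGeometry.Deformation` (THEOREMS only: no
definition, no instance, no notation, no named fact).  Currency of ★ c2b `FlatDeformationTransitionData` and ★ GAP-1
`SmoothSchemeLiftTransitionDataLift`: `π' : Ā → k` the augmentation of an (Artinian local) `k`-algebra `Ā = A ⧸ J`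
(`J² = 0`), the closed fibre `X/k` (smooth; `k`-structures `halg`), a flat deformation `Y/Ā` (`Ā`-structures `halgA`),
`i : X → Y` the closed-fibre inclusion (`hi`); chart trivialisations `ε s : Ā ⊗_k Γ(X, V s) ≃ₐ[Ā] Γ(Y, Ṽ s)` over the closed
fibres of a principal affine cover `V` of `X` (`Ṽ s ⊆ Y` the opens above `V s`), their overlap restrictions, the transition
automorphisms `transition ε₁ ε₂ = ε₂⁻¹ ε₁` of `Ā ⊗_k Γ(X, V s ∩ V t)`, and `A`-lifts `ψ` of them along `σ̂ = mk_J ⊗ 1`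
(GAP-1's clause (L)).

THE PRINT. [Hartshorne2010, Thm. 10.2 (a), proof, p. 81]: the trivialisations `U'_i ≅ U_i × Spec C'` of [Hartshorne2010, Cor.
4.8] are «unique up to» an automorphism inducing the identity on the closed fibre; two choices `φ_i, φ'_i` differ by
`F_i = φ'_i⁻¹ φ_i`, and the transition data transform as `ψ'_{ij} F_i = F_j ψ_{ij}`.  THIS FILE: for TWO trivialisation
systems `ε, ε″` of the SAME deformation `Y` on the SAME principal affine cover `V` (with their overlap restrictions
`ε₁ ε₂`, `ε″₁ ε″₂`) and `A`-lifts `ψV`, `ψ″V` of their transition data (`J² = 0`), there are chart automorphisms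
`F s` of `A ⊗_k Γ(X, V s)`, `≡ 1 (mod mk_J⁻¹ ker π')`, INTERTWINING the two lift systems modulo `J`:
`F_t| (ψV s t (1 ⊗ c)) − ψ″V s t (F_s| (1 ⊗ c)) ∈ J·(A ⊗ Γ(X, V s ∩ V t))` for all characterised restrictions `F_s|, F_t|`
(**`exists_chartAut_of_two_chart_systems`**) — exactly the hypothesis `hFψ` of ★ `SmoothSchemeLiftObstructionConjugate`
(`exists_cechMD1_eq_sub_of_conj`), so the two obstruction cochains differ by a Čech coboundary.  Road: `F̄ s :=
transition (ε s) (ε″ s)` is `≡ 1 (mod ker π')` (★ `transition_apply_sub_mem`); `F s` := an `A`-lift (★ A3a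
`exists_lift_of_sq_zero`, `Γ(X, V s)` formally smooth); modulo `J` (i.e. after `σ̂`, ★ `reductionHom_eq_zero_iff`) the
intertwining identity is `transition(ε₂, ε″₂) ∘ transition(ε₁, ε₂) = transition(ε″₁, ε″₂) ∘ transition(ε₁, ε″₁)` on
`V s ∩ V t` (both are `ε″₂⁻¹ ε₁`), the restrictions of `F̄ s, F̄ t` to the overlap being these transitions (★ c1
`eq_transition_of_restrict`) and `σ̂` being natural for restrictions (★ GAP-1 `reductionHom_algEquiv_restrict`).

Cell `hodgecm-mathlib`, F-11 road (a′), slot (4) rel₂: the chart-automorphism input of the same-cover half.  HC_CM is proved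
only modulo the 7 printed citations until rung 0 closes — nothing here bears on a summit statement.

## References
* [Hartshorne2010] R. Hartshorne, *Deformation Theory*, GTM 257, Springer (2010): Thm. 10.2 (a) and its proof (p. 81),
  Cor. 4.8 (pp. 32–33), Thm. 5.3 (proof, p. 42: `ψ_{ij} = φ_j⁻¹ φ_i`).
* [AtiyahMacdonald1969] M. F. Atiyah, I. G. Macdonald, *Introduction to Commutative Algebra* (1969): Prop. 3.5.
-/

noncomputable section

-- `TopCat.Presheaf`/`TopCat.Sheaf` are not reducible (as in Mathlib's `AlgebraicGeometry/Modules`).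
set_option backward.isDefEq.respectTransparency false

open CategoryTheory AlgebraicGeometry Opposite TopologicalSpace Limits
open scoped TensorProduct

universe u

namespace Literature.AlgebraicGeometry.Deformation

open Literature.AlgebraicGeometry.Motives Literature.AlgebraicGeometry.Morphisms SmoothAffineDeformation

variable {k : Type u} [Field k] {A : Type u} [CommRing A] [Algebra k A] {J : Ideal A} (π' : (A ⧸ J) →ₐ[k] k)
  {X : Over (Spec (CommRingCat.of k))} [instΓ : ∀ W : X.left.Opens, Algebra k Γ(X.left, W)]
  (halg : ∀ (W : X.left.Opens) (s : k), algebraMap k Γ(X.left, W) s = (constToPresheaf X).app (op W) s)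
  {Y : Over (Spec (CommRingCat.of (A ⧸ J)))} [instΓA : ∀ W : Y.left.Opens, Algebra (A ⧸ J) Γ(Y.left, W)]
  (halgA : ∀ (W : Y.left.Opens) (a : A ⧸ J), algebraMap (A ⧸ J) Γ(Y.left, W) a = (constToPresheaf Y).app (op W) a)
  (i : X.left ⟶ Y.left) (hi : IsPullback i X.hom Y.hom (Spec.map (CommRingCat.ofHom π'.toRingHom)))

include halg in
/-- Restriction `Γ(X, V) → Γ(X, W)` commutes with the `k`-structures fixed by `halg` (for the canonical instance this is
★ `Motives.FieldNorm.map_algebraMap_sec`, whence `private`). [cite: Hartshorne1977, II.8 p. 172] -/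
private theorem map_algebraMap_halg {V W : X.left.Opens} (h : W ≤ V) (s : k) :
    X.left.presheaf.map (homOfLE h).op (algebraMap k Γ(X.left, V) s) = algebraMap k Γ(X.left, W) s := by
  rw [halg, halg, map_constToPresheaf_app_of_le]

include hi halg halgA in
/-- **The comparison `F̄ = transition ε ε″ = ε″⁻¹ ε` of two trivialisations of the same chart over the closed fibre
induces the identity modulo `ker π'`** (★ `transition_apply_sub_mem` on the scheme). [cite: Hartshorne2010, Thm. 5.3 (proof), p. 42]
[cite: Hartshorne2010, Cor. 4.8, pp. 32–33] -/
theorem transition_charts_sub_mem {V : X.left.Opens} {W : Y.left.Opens} (hV : V ≤ i ⁻¹ᵁ W)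
    (ε ε'' : (A ⧸ J) ⊗[k] Γ(X.left, V) ≃ₐ[A ⧸ J] Γ(Y.left, W))
    (hε : ∀ x, i.appLE W V hV (ε x) = specialFibreHom π' _ x)
    (hε'' : ∀ x, i.appLE W V hV (ε'' x) = specialFibreHom π' _ x) (x : (A ⧸ J) ⊗[k] Γ(X.left, V)) :
    transition ε ε'' x - x ∈ (RingHom.ker π') • (⊤ : Submodule (A ⧸ J) ((A ⧸ J) ⊗[k] Γ(X.left, V))) := by
  letI algkW : Algebra k Γ(Y.left, W) := ((algebraMap (A ⧸ J) Γ(Y.left, W)).comp (algebraMap k (A ⧸ J))).toAlgebra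
  let ρ : Γ(Y.left, W) →ₐ[k] Γ(X.left, V) :=
    { (i.appLE W V hV).hom with
      commutes' := fun c => appLE_algebraMap π' halg halgA i hi hV c }
  exact transition_apply_sub_mem π' ρ ε ε'' hε hε'' x

include hi halg halgA in
/-- **TWO TRIVIALISATION SYSTEMS OF ONE FLAT DEFORMATION ON ONE PRINCIPAL AFFINE COVER HAVE INTERTWINED TRANSITION LIFTS.**
For chart systems `ε, ε″` of `Y` on the principal affine cover `V` of the closed fibre (over the closed fibres), their
overlap restrictions `ε₁ ε₂`, `ε″₁ ε″₂`, and `A`-lifts `ψV`, `ψ″V` of the transition data (`σ̂ ∘ ψV s t = transition (ε₁ s t)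
(ε₂ s t) ∘ σ̂`, `σ̂ = mk_J ⊗ 1`), there are `A`-automorphisms `F s` of the charts `A ⊗_k Γ(X, V s)`, `≡ 1 (mod mk_J⁻¹ ker π')`,
with `F_t| (ψV s t (1 ⊗ c)) − ψ″V s t (F_s| (1 ⊗ c)) ∈ J·(A ⊗_k Γ(X, V s ∩ V t))` for all characterised restrictions
`F_s|, F_t|` — the hypothesis `hFψ` of ★ `exists_cechMD1_eq_sub_of_conj`. [cite: Hartshorne2010, Thm. 10.2 (proof), p. 81]
[cite: Hartshorne2010, Cor. 4.8, pp. 32–33] -/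
theorem exists_chartAut_of_two_chart_systems [Smooth X.hom] (hJJ : J * J = ⊥) (h𝔫 : IsNilpotent (RingHom.ker π'))
    {κ : Type u} (V : κ → X.left.affineOpens) (c : (s t : κ) → Γ(X.left, (V s).1))
    (hc : ∀ s t, (V s).1 ⊓ (V t).1 = X.left.basicOpen (c s t))
    (W : κ → Y.left.Opens) (hW : ∀ s, (V s).1 ≤ i ⁻¹ᵁ (W s))
    (ε ε'' : ∀ s, (A ⧸ J) ⊗[k] Γ(X.left, (V s).1) ≃ₐ[A ⧸ J] Γ(Y.left, W s))
    (hε : ∀ s x, i.appLE (W s) (V s).1 (hW s) (ε s x) = specialFibreHom π' _ x)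
    (hε'' : ∀ s x, i.appLE (W s) (V s).1 (hW s) (ε'' s x) = specialFibreHom π' _ x)
    (ε₁ ε₂ ε''₁ ε''₂ : ∀ s t, (A ⧸ J) ⊗[k] Γ(X.left, (V s).1 ⊓ (V t).1) ≃ₐ[A ⧸ J] Γ(Y.left, W s ⊓ W t))
    (hε₁ : ∀ s t (a : A ⧸ J) (x : Γ(X.left, (V s).1)),
      ε₁ s t (a ⊗ₜ X.left.presheaf.map (homOfLE inf_le_left).op x) =
        Y.left.presheaf.map (homOfLE inf_le_left).op (ε s (a ⊗ₜ x)))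
    (hε₂ : ∀ s t (a : A ⧸ J) (x : Γ(X.left, (V t).1)),
      ε₂ s t (a ⊗ₜ X.left.presheaf.map (homOfLE inf_le_right).op x) =
        Y.left.presheaf.map (homOfLE inf_le_right).op (ε t (a ⊗ₜ x)))
    (hε''₁ : ∀ s t (a : A ⧸ J) (x : Γ(X.left, (V s).1)),
      ε''₁ s t (a ⊗ₜ X.left.presheaf.map (homOfLE inf_le_left).op x) =
        Y.left.presheaf.map (homOfLE inf_le_left).op (ε'' s (a ⊗ₜ x)))
    (hε''₂ : ∀ s t (a : A ⧸ J) (x : Γ(X.left, (V t).1)),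
      ε''₂ s t (a ⊗ₜ X.left.presheaf.map (homOfLE inf_le_right).op x) =
        Y.left.presheaf.map (homOfLE inf_le_right).op (ε'' t (a ⊗ₜ x)))
    (ψV ψ''V : ∀ s t, A ⊗[k] Γ(X.left, (V s).1 ⊓ (V t).1) ≃ₐ[A] A ⊗[k] Γ(X.left, (V s).1 ⊓ (V t).1))
    (hLV : ∀ s t x, Algebra.TensorProduct.map (Ideal.Quotient.mkₐ k J) (AlgHom.id k Γ(X.left, (V s).1 ⊓ (V t).1))
        (ψV s t x) = transition (ε₁ s t) (ε₂ s t)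
        (Algebra.TensorProduct.map (Ideal.Quotient.mkₐ k J) (AlgHom.id k Γ(X.left, (V s).1 ⊓ (V t).1)) x))
    (hL''V : ∀ s t x, Algebra.TensorProduct.map (Ideal.Quotient.mkₐ k J) (AlgHom.id k Γ(X.left, (V s).1 ⊓ (V t).1))
        (ψ''V s t x) = transition (ε''₁ s t) (ε''₂ s t)
        (Algebra.TensorProduct.map (Ideal.Quotient.mkₐ k J) (AlgHom.id k Γ(X.left, (V s).1 ⊓ (V t).1)) x)) :
    ∃ F : ∀ s, A ⊗[k] Γ(X.left, (V s).1) ≃ₐ[A] A ⊗[k] Γ(X.left, (V s).1),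
      (∀ s x, F s x - x ∈
        ((RingHom.ker π').comap (Ideal.Quotient.mk J)) • (⊤ : Submodule A (A ⊗[k] Γ(X.left, (V s).1)))) ∧
      ∀ (s t : κ)
        (Φs : A ⊗[k] Γ(X.left, (V s).1) →ₐ[A] A ⊗[k] Γ(X.left, (V s).1 ⊓ (V t).1))
        (_ : ∀ a x, Φs (a ⊗ₜ x) = a ⊗ₜ X.left.presheaf.map (homOfLE inf_le_left).op x)
        (Φt : A ⊗[k] Γ(X.left, (V t).1) →ₐ[A] A ⊗[k] Γ(X.left, (V s).1 ⊓ (V t).1))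
        (_ : ∀ a x, Φt (a ⊗ₜ x) = a ⊗ₜ X.left.presheaf.map (homOfLE inf_le_right).op x)
        (Fs Ft : A ⊗[k] Γ(X.left, (V s).1 ⊓ (V t).1) ≃ₐ[A] A ⊗[k] Γ(X.left, (V s).1 ⊓ (V t).1)),
        (∀ x, Fs (Φs x) = Φs (F s x)) → (∀ x, Ft (Φt x) = Φt (F t x)) →
        ∀ c₀ : Γ(X.left, (V s).1 ⊓ (V t).1),
          Ft (ψV s t ((1 : A) ⊗ₜ c₀)) - ψ''V s t (Fs ((1 : A) ⊗ₜ c₀)) ∈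
            J • (⊤ : Submodule A (A ⊗[k] Γ(X.left, (V s).1 ⊓ (V t).1))) := by
  classical
  -- the reduction `σ = mk_J : A → A ⧸ J`, surjective with square-zero kernel `J`
  let σ : A →ₐ[k] A ⧸ J := Ideal.Quotient.mkₐ k J
  have hσ : Function.Surjective σ := Ideal.Quotient.mkₐ_surjective k J
  have hker : RingHom.ker σ = J := Ideal.Quotient.mkₐ_ker k J
  have hker2 : RingHom.ker σ * RingHom.ker σ = ⊥ := by rw [hker]; exact hJJ
  -- (1) the comparison automorphisms `F̄ s = transition (ε s) (ε″ s)` over `A ⧸ J`, `≡ 1 (mod ker π')`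
  have hFbar : ∀ s x, transition (ε s) (ε'' s) x - x ∈
      (RingHom.ker π') • (⊤ : Submodule (A ⧸ J) ((A ⧸ J) ⊗[k] Γ(X.left, (V s).1))) := fun s =>
    transition_charts_sub_mem π' halg halgA i hi (hW s) (ε s) (ε'' s) (hε s) (hε'' s)
  -- (2) their `A`-lifts (★ A3a `exists_lift_of_sq_zero`; the chart rings are formally smooth over `k`)
  have hlift : ∀ s, ∃ F : A ⊗[k] Γ(X.left, (V s).1) ≃ₐ[A] A ⊗[k] Γ(X.left, (V s).1),
      ∀ x, reductionHom σ _ (F x) = transition (ε s) (ε'' s) (reductionHom σ _ x) := fun s => by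
    haveI : Algebra.FormallySmooth k Γ(X.left, (V s).1) := formallySmooth_sections_halg_of_isAffineOpen halg (V s).2
    exact exists_lift_of_sq_zero σ hσ hker2 _
  choose F hFlift using hlift
  refine ⟨F, fun s x => ?_, ?_⟩
  · -- `F s ≡ 1 (mod mk_J⁻¹ ker π')`
    have hz : reductionHom σ _ (F s x - x) ∈
        (RingHom.ker π') • (⊤ : Submodule (A ⧸ J) ((A ⧸ J) ⊗[k] Γ(X.left, (V s).1))) := by
      rw [map_sub, hFlift]
      exact hFbar s _
    exact mem_comap_smul_top_of_reductionHom_mem σ hσ (RingHom.ker π') hz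
  -- (3) the intertwining identity modulo `J`: after `σ̂` both sides are `ε″₂⁻¹ ε₁`
  intro s t Φs hΦs Φt hΦt Fs Ft hFs hFt c₀
  rw [← hker, ← reductionHom_eq_zero_iff σ hσ, map_sub, sub_eq_zero]
  have hLVr : ∀ x, reductionHom σ _ (ψV s t x) = transition (ε₁ s t) (ε₂ s t) (reductionHom σ _ x) := hLV s t
  have hL''Vr : ∀ x, reductionHom σ _ (ψ''V s t x) = transition (ε''₁ s t) (ε''₂ s t) (reductionHom σ _ x) :=
    hL''V s t
  -- base changes over `A ⧸ J` and the restrictions `Gs, Gt` of `F̄ s, F̄ t` to the overlap (★ F1/F2)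
  have hVts : (V s).1 ⊓ (V t).1 = X.left.basicOpen (c t s) := by
    rw [inf_comm]
    exact hc t s
  obtain ⟨Ψs, hΨs⟩ := exists_baseChangeMap (A' := A ⧸ J) halg (V s).1 ((V s).1 ⊓ (V t).1) inf_le_left
  obtain ⟨Ψt, hΨt⟩ := exists_baseChangeMap (A' := A ⧸ J) halg (V t).1 ((V s).1 ⊓ (V t).1) inf_le_right
  obtain ⟨Gs, hGs, -⟩ := exists_algEquiv_restrict halg (RingHom.ker π') (V s).2 (c s t) (hc s t) inf_le_left h𝔫
    (transition (ε s) (ε'' s)) (hFbar s) hΨs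
  obtain ⟨Gt, hGt, -⟩ := exists_algEquiv_restrict halg (RingHom.ker π') (V t).2 (c t s) hVts inf_le_right h𝔫
    (transition (ε t) (ε'' t)) (hFbar t) hΨt
  -- `σ̂` is natural for the restrictions (★ GAP-1)
  have hnatS : ∀ y, reductionHom σ _ (Fs y) = Gs (reductionHom σ _ y) :=
    reductionHom_algEquiv_restrict σ (V s).2 (c s t) (hc s t) inf_le_left (F s) (transition (ε s) (ε'' s)) (hFlift s)
      hΦs hΨs hFs hGs
  have hnatT : ∀ y, reductionHom σ _ (Ft y) = Gt (reductionHom σ _ y) :=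
    reductionHom_algEquiv_restrict σ (V t).2 (c t s) hVts inf_le_right (F t) (transition (ε t) (ε'' t)) (hFlift t)
      hΦt hΨt hFt hGt
  -- the restricted comparisons ARE the transitions of the restricted charts (★ c1 `eq_transition_of_restrict`)
  have hGs' : Gs = transition (ε₁ s t) (ε''₁ s t) := by
    letI algX : Algebra Γ(X.left, (V s).1) Γ(X.left, (V s).1 ⊓ (V t).1) :=
      (X.left.presheaf.map (homOfLE (inf_le_left : (V s).1 ⊓ (V t).1 ≤ (V s).1)).op).hom.toAlgebra
    haveI : IsScalarTower k Γ(X.left, (V s).1) Γ(X.left, (V s).1 ⊓ (V t).1) :=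
      IsScalarTower.of_algebraMap_eq fun c => (map_algebraMap_halg halg inf_le_left c).symm
    haveI : IsLocalization.Away (c s t) Γ(X.left, (V s).1 ⊓ (V t).1) :=
      (V s).2.isLocalization_of_eq_basicOpen (c s t) (homOfLE inf_le_left) (hc s t)
    letI algY : Algebra Γ(Y.left, W s) Γ(Y.left, W s ⊓ W t) :=
      (Y.left.presheaf.map (homOfLE (inf_le_left : W s ⊓ W t ≤ W s)).op).hom.toAlgebra
    haveI : IsScalarTower (A ⧸ J) Γ(Y.left, W s) Γ(Y.left, W s ⊓ W t) :=
      IsScalarTower.of_algebraMap_eq fun a => (map_algebraMap_A halgA inf_le_left a).symm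
    exact eq_transition_of_restrict (k := k) (c s t) (ε s) (ε'' s) (ε₁ s t) (ε''₁ s t) (hε₁ s t) (hε''₁ s t) hΨs Gs hGs
  have hGt' : Gt = transition (ε₂ s t) (ε''₂ s t) := by
    letI algX : Algebra Γ(X.left, (V t).1) Γ(X.left, (V s).1 ⊓ (V t).1) :=
      (X.left.presheaf.map (homOfLE (inf_le_right : (V s).1 ⊓ (V t).1 ≤ (V t).1)).op).hom.toAlgebra
    haveI : IsScalarTower k Γ(X.left, (V t).1) Γ(X.left, (V s).1 ⊓ (V t).1) :=
      IsScalarTower.of_algebraMap_eq fun c => (map_algebraMap_halg halg inf_le_right c).symm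
    haveI : IsLocalization.Away (c t s) Γ(X.left, (V s).1 ⊓ (V t).1) :=
      (V t).2.isLocalization_of_eq_basicOpen (c t s) (homOfLE inf_le_right) hVts
    letI algY : Algebra Γ(Y.left, W t) Γ(Y.left, W s ⊓ W t) :=
      (Y.left.presheaf.map (homOfLE (inf_le_right : W s ⊓ W t ≤ W t)).op).hom.toAlgebra
    haveI : IsScalarTower (A ⧸ J) Γ(Y.left, W t) Γ(Y.left, W s ⊓ W t) :=
      IsScalarTower.of_algebraMap_eq fun a => (map_algebraMap_A halgA inf_le_right a).symm
    exact eq_transition_of_restrict (k := k) (c t s) (ε t) (ε'' t) (ε₂ s t) (ε''₂ s t) (hε₂ s t) (hε''₂ s t) hΨt Gt hGt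
  rw [hnatT, hLVr, hGt', hL''Vr, hnatS, hGs']
  simp only [transition_apply, AlgEquiv.apply_symm_apply]

end Literature.AlgebraicGeometry.Deformation

end
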